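import Literature.NumberTheory.GaloisRepresentations.IdeleClassBarSRelativeLayers
import Literature.NumberTheory.GaloisRepresentations.IdeleTruncatedSLocalization
import Literature.NumberTheory.GaloisRepresentations.CompletionCompositumEmbedding
import Literature.Algebra.Homology.DiscreteRepLayerInflationPullback
import Literature.Algebra.Homology.DiscreteRepCoindPullbackShapiro
import HarnessLib

/-!
# The local layer group `V_v ⧸ N_{v,s}` of the `S`-idèle localisation IS the decomposition group `G_{w_s}(E/L)` of the
# place `w_s` cut out by the twisted embedding `K̄ →(s⁻¹)→ K̄ → K̄_v` (Cassels–Fröhlich VII §1.1; Harari §17.5 Lemma 17.23)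

Topic `NumberTheory/GaloisRepresentations`; namespace `Literature.NumberTheory.GaloisRepresentations.IdeleReadout`.
Definitions with bodies and theorems; NO named fact, no `sorry`, no instance, no notation; number fields in `Type`.

SETTING (lane «PT-Ш-S-TC» of cell `bsd-eis`, crux `GoodLatticeBDPValue` = stmt-BirchSwinnertonDyer-19032, brick
[P2-mono] / file P2-b of `P2-MONO-SCOPING-w3g18-v2.md`, sub-lemma (i) «the local identification» asked for by
bsd-line-x1-p1-w8 g13; this is its GROUP half, the module/cohomology half is `LocalUnitsLayerCompletionIso.lean`).
`K` a number field, `S` a finite set of finite places, `G_S = Gal(K_S/K)`, `U ≤ G_S` normal, `E ⊆ K_S` a finite Galois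
layer (`E : GalLayer K`, `hE`) with `V̄_E = Gal(K_S/E) ≤ U` (`hEU`), `H_E := subgroupImageS S hE U ≤ Gal(E/K)` the image
of `U`, `L := E^{H_E}` (`locFixedField`); `v` a FINITE place of `K`, `φ_v = decompMapPlaceS K S (inr v) : Γ_{K_v} → G_S`,
`V_v := φ_v⁻¹ U`, and for `s ∈ G_S` the conjugated map `ψ_s = conjHom φ_v U s : V_v → U` (bsd-eis -w4 g20) with the open
normal subgroup `N_{v,s} := ψ_s⁻¹(V̄_E ∩ U) ≤ V_v` (bsd-eis -w7 g13 `comapOpenNormalSubgroup`, door-c4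
`traceOpenNormalSubgroup`) — EXACTLY the data `locConjHom` / `locLayerSubgroup` of LEAD bsd-line-x1-p1 g11's
`IdeleTruncatedSLocalLayerClass` at `w = ⟨inr v, _⟩`, `s = dcRep … t` (stated here for a general `s`).

* §1 `twistEmb` (`ι_s := (E ⊆ K̄) ∘ g_s⁻¹`, `g_s := s|_E`), `locRestrict` (`ρ_s : d ↦ g_s (d|_E) g_s⁻¹`), the KEY formula
  `twistEmb_locRestrict` (`ι_s (ρ_s(d) e) = d|_{K̄} • ι_s e`: `ρ_s(d)` is the restriction of `d` to `E` along `ι_s`),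
  `locRestrict_eq_restrictHomS_conjHom` (`ρ_s = (ψ_s ·)|_E` on `V_v`), `locRestrict_eq_one_iff(_mem)` (kernel `N_{v,s}`).
* §2 `locPlace` (`w_s := embPlace v ι_s`), `locPlaceOver` (the same above the place `u` of `L` below it), `locDecompHom`,
  **`locDecompEquiv : V_v ⧸ N_{v,s} ≃* G_{w_s}(E/L)`** (the stabiliser of `w_s` in `Gal(E/L)`), `d ↦ ρ_s(d)`.
* §2b dictionary with the CANONICAL embedding `ι = E ⊆ K̄`, `w̄_E = embPlace v ι`: **`w_s = g_s • w̄_E`**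
  (`smul_embPlace_eq_locPlace`) and **`placeEmb_{ι_s} = placeEmb_ι ∘ (g_s⁻¹)_*`** (`placeEmb_twistEmb_eq`).

HONEST FRAMING: local Galois bookkeeping (which completed layer a conjugated local restriction reads); no arithmetic
duality statement and nothing about BSD is proved here.  AI formalisation, established only by the kernel check.

## References
* J. W. S. Cassels, A. Fröhlich (eds.), *Algebraic Number Theory* (1967), Ch. II (Cassels) §10, Ch. VII (Tate) §1.1,
  Prop. 1.2. [CasselsFrohlichANT1967]
* D. Harari, *Galois Cohomology and Class Field Theory*, Universitext (2020), §13.1, §17.5 Lemma 17.23, Prop. 17.25. [Harari2020]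
* J. Neukirch, *Algebraic Number Theory* (1999), Ch. II (8.1)–(8.3). [NeukirchANT1999]
* J.-P. Serre, *Local Fields*, GTM 67 (1979), VII §5. [Serre1979]
-/

noncomputable section

open NumberField IsDedekindDomain Field CategoryTheory
open Literature.Algebra.Homology Literature.Algebra.Homology.DiscreteRep
open Literature.NumberTheory.Automorphic

namespace Literature.NumberTheory.GaloisRepresentations

namespace IdeleReadout

open IdeleClassBar SemiLocal
open Literature.NumberTheory.GaloisRepresentations.LocalWeilDatum (galFixing)

/-! ## §0 Generic: an automorphism in a subgroup `H ≤ Gal(L/F)` as an automorphism over the fixed field `L^H` -/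

section Generic

variable {F L : Type} [Field F] [Field L] [Algebra F L]

/-- An `F`-automorphism `g ∈ H` of `L` is an `L^H`-automorphism. [cite: Serre1979, VII §5] -/
def algEquivFixedField (H : Subgroup (L ≃ₐ[F] L)) (g : L ≃ₐ[F] L) (hg : g ∈ H) :
    L ≃ₐ[IntermediateField.fixedField H] L :=
  { g.toRingEquiv with commutes' := fun x => x.2 ⟨g, hg⟩ }

/-- Formula. [cite: Serre1979, VII §5] -/
@[simp] theorem algEquivFixedField_apply (H : Subgroup (L ≃ₐ[F] L)) (g : L ≃ₐ[F] L) (hg : g ∈ H) (x : L) :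
    algEquivFixedField H g hg x = g x := rfl

/-- Restricting scalars back to `F` recovers `g`. [cite: Serre1979, VII §5] -/
@[simp] theorem restrictScalars_algEquivFixedField (H : Subgroup (L ≃ₐ[F] L)) (g : L ≃ₐ[F] L) (hg : g ∈ H) :
    (algEquivFixedField H g hg).restrictScalars F = g := AlgEquiv.ext fun _ => rfl

/-- Every `L^H`-automorphism restricts to an element of `H` (`L/F` finite: `Gal(L/L^H) = H`).
[cite: Serre1979, VII §5] -/
theorem restrictScalars_mem_of_fixedField [FiniteDimensional F L] (H : Subgroup (L ≃ₐ[F] L))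
    (g : L ≃ₐ[IntermediateField.fixedField H] L) : g.restrictScalars F ∈ H := by
  have h : g.restrictScalars F ∈ IntermediateField.fixingSubgroup (IntermediateField.fixedField H) :=
    fun x => g.commutes x
  rwa [IntermediateField.fixingSubgroup_fixedField] at h

end Generic

variable (K : Type) [Field K] [NumberField K] (S : Finset (HeightOneSpectrum (𝓞 K)))
  (U : Subgroup (GaloisGroupUnramifiedOutside K (↑S : Set (HeightOneSpectrum (𝓞 K))))) [hUn : U.Normal]
  {E : GalLayer K} [IsGalois K E.1] [NumberField E.1]
  (hE : ramificationSubgroup K (↑S : Set (HeightOneSpectrum (𝓞 K))) ≤ galFixing K E.1)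
  (hEU : (layerSubgroupS S E : Subgroup (GaloisGroupUnramifiedOutside K (↑S : Set (HeightOneSpectrum (𝓞 K))))) ≤ U)
  (v : HeightOneSpectrum (𝓞 K)) (s : GaloisGroupUnramifiedOutside K (↑S : Set (HeightOneSpectrum (𝓞 K))))

/-! ## §1 The twisted embedding `ι_s = (E ⊆ K̄) ∘ g_s⁻¹` and the local restriction `ρ_s : Γ_{K_v} → Gal(E/K)` -/

section Restrict

omit [IsGalois K E.1] [NumberField E.1] in
/-- **The twisted embedding `ι_s : E → K̄`, `e ↦ g_s⁻¹ e`** (`g_s = s|_E`). [cite: CasselsFrohlichANT1967, Ch. VII §1.1] -/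
def twistEmb : E.1 →ₐ[K] AlgebraicClosure K :=
  (E.1.val).comp ((restrictHomS S hE s).symm : E.1 ≃ₐ[K] E.1)

omit [IsGalois K E.1] [NumberField E.1] in
/-- Formula: `ι_s e = g_s⁻¹ e` in `K̄`. [cite: CasselsFrohlichANT1967, Ch. VII §1.1] -/
@[simp] theorem twistEmb_apply (e : E.1) :
    twistEmb K S hE s e = (((restrictHomS S hE s).symm e : E.1) : AlgebraicClosure K) := rfl

omit [IsGalois K E.1] [NumberField E.1] in
/-- **The local restriction `ρ_s : Γ_{K_v} → Gal(E/K)`, `d ↦ g_s (d|_E) g_s⁻¹`** (`d|_E = (φ_v d)|_E`, `restrictHomS`).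
[cite: CasselsFrohlichANT1967, Ch. VII §1.1][cite: Harari2020, §17.5 Lemma 17.23] -/
def locRestrict : absoluteGaloisGroup (Place.Completion (Sum.inr v : Place K)) →* (E.1 ≃ₐ[K] E.1) :=
  (MulAut.conj (restrictHomS S hE s)).toMonoidHom.comp
    ((restrictHomS S hE).comp (decompMapPlaceS K S (Sum.inr v : Place K)))

omit [IsGalois K E.1] [NumberField E.1] in
/-- Formula. [cite: Harari2020, §17.5 Lemma 17.23] -/
theorem locRestrict_apply (d : absoluteGaloisGroup (Place.Completion (Sum.inr v : Place K))) :
    locRestrict K S hE v s d =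
      restrictHomS S hE s * restrictHomS S hE (decompMapPlaceS K S (Sum.inr v : Place K) d) * (restrictHomS S hE s)⁻¹ :=
  rfl

omit [IsGalois K E.1] [NumberField E.1] in
/-- `(φ_v d)|_E = (d|_{K̄})|_E`. [cite: Harari2020, §17.5 Lemma 17.23] -/
theorem restrictHomS_decompMapPlaceS (d : absoluteGaloisGroup (Place.Completion (Sum.inr v : Place K))) :
    restrictHomS S hE (decompMapPlaceS K S (Sum.inr v : Place K) d) =
      GalLayer.restrictHom E (absGaloisRestrict K (v.adicCompletion K) d) :=
  restrictHomS_mk S hE _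

omit [IsGalois K E.1] [NumberField E.1] in
/-- **KEY: `ι_s (ρ_s(d) e) = d|_{K̄} • ι_s e`** — `ρ_s(d)` is THE restriction of `d` to `E` along the twisted embedding
(the hypothesis `hg` of the tree's `CompletionCompositumEmbedding` lemmas for `ιE := ι_s`). [cite: CasselsFrohlichANT1967, Ch. VII §1.1] -/
theorem twistEmb_locRestrict (d : absoluteGaloisGroup (Place.Completion (Sum.inr v : Place K))) (e : E.1) :
    twistEmb K S hE s (locRestrict K S hE v s d e) =
      absGaloisRestrict K (v.adicCompletion K) d • twistEmb K S hE s e := by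
  rw [twistEmb_apply, twistEmb_apply, locRestrict_apply, restrictHomS_decompMapPlaceS, AlgEquiv.mul_apply,
    AlgEquiv.mul_apply, AlgEquiv.aut_inv, AlgEquiv.symm_apply_apply]
  exact GalLayer.coe_restrictHom_apply E _ _

omit [IsGalois K E.1] [NumberField E.1] in
/-- `ι_s` hits every element of `E ⊆ K̄`: `ι_s (g_s e) = e`. [cite: CasselsFrohlichANT1967, Ch. VII §1.1] -/
theorem twistEmb_restrictHomS_apply (e : E.1) :
    twistEmb K S hE s (restrictHomS S hE s e) = (e : AlgebraicClosure K) := by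
  rw [twistEmb_apply, AlgEquiv.symm_apply_apply]

omit [IsGalois K E.1] [NumberField E.1] in
/-- **On `V_v = φ_v⁻¹U`, `ρ_s(d) = (ψ_s d)|_E`** (`ψ_s = conjHom φ_v U s`). [cite: Harari2020, §17.5 Lemma 17.23] -/
theorem locRestrict_eq_restrictHomS_conjHom (d : ↥(U.comap (decompMapPlaceS K S (Sum.inr v : Place K)))) :
    locRestrict K S hE v s d =
      restrictHomS S hE (conjHom (decompMapPlaceS K S (Sum.inr v : Place K)) U s d :
        GaloisGroupUnramifiedOutside K (↑S : Set (HeightOneSpectrum (𝓞 K)))) := by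
  rw [locRestrict_apply, coe_conjHom_apply, map_mul, map_mul, map_inv]

omit [IsGalois K E.1] [NumberField E.1] in
/-- `ρ_s(d) ∈ H_E` for `d ∈ V_v`. [cite: Harari2020, §17.5 Lemma 17.23] -/
theorem locRestrict_mem (d : ↥(U.comap (decompMapPlaceS K S (Sum.inr v : Place K)))) :
    locRestrict K S hE v s d ∈ subgroupImageS S hE U := by
  rw [locRestrict_eq_restrictHomS_conjHom]
  exact Subgroup.mem_map_of_mem _ (conjHom _ U s d).2

omit [IsGalois K E.1] [NumberField E.1] in
/-- **`ρ_s(d) = 1 ↔ φ_v d ∈ V̄_E`.** [cite: Harari2020, §17.5 Lemma 17.23] -/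
theorem locRestrict_eq_one_iff (d : absoluteGaloisGroup (Place.Completion (Sum.inr v : Place K))) :
    locRestrict K S hE v s d = 1 ↔
      decompMapPlaceS K S (Sum.inr v : Place K) d ∈
        (layerSubgroupS S E : Subgroup (GaloisGroupUnramifiedOutside K (↑S : Set (HeightOneSpectrum (𝓞 K))))) := by
  rw [locRestrict_apply, ← restrictHomS_eq_one_iff S hE, ← MulAut.conj_apply, MulEquiv.map_eq_one_iff]

omit [IsGalois K E.1] [NumberField E.1] in
/-- **On `V_v`, `ρ_s(d) = 1 ↔ d ∈ N_{v,s}`** (`N_{v,s} = ψ_s⁻¹(V̄_E ∩ U)`). [cite: Harari2020, §17.5 Lemma 17.23] -/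
theorem locRestrict_eq_one_iff_mem (d : ↥(U.comap (decompMapPlaceS K S (Sum.inr v : Place K)))) :
    locRestrict K S hE v s d = 1 ↔
      d ∈ (comapOpenNormalSubgroup (conjHom (decompMapPlaceS K S (Sum.inr v : Place K)) U s)
        (continuous_conjHom (decompMapPlaceS K S (Sum.inr v : Place K)) (continuous_decompMapPlaceS K S _) U s)
        (traceOpenNormalSubgroup U (layerSubgroupS S E)) : Subgroup ↥(U.comap (decompMapPlaceS K S (Sum.inr v : Place K)))) := by
  rw [locRestrict_eq_restrictHomS_conjHom, restrictHomS_eq_one_iff]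
  exact Iff.rfl

omit [IsGalois K E.1] [NumberField E.1] in
/-- **An element of `Γ_{K_v}` fixing `ι_s(E)` pointwise maps into `V̄_E` under `φ_v`.** [cite: CasselsFrohlichANT1967, Ch. VII §1.1] -/
theorem decompMapPlaceS_mem_layerSubgroupS_of_forall_smul (d : absoluteGaloisGroup (Place.Completion (Sum.inr v : Place K)))
    (hd : ∀ e : E.1, absGaloisRestrict K (v.adicCompletion K) d • twistEmb K S hE s e = twistEmb K S hE s e) :
    decompMapPlaceS K S (Sum.inr v : Place K) d ∈
      (layerSubgroupS S E : Subgroup (GaloisGroupUnramifiedOutside K (↑S : Set (HeightOneSpectrum (𝓞 K))))) := by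
  refine mk_mem_layerSubgroupS S E ((LocalWeilDatum.mem_galFixing_iff (F := K)).2 fun x hx => ?_)
  have h := hd (restrictHomS S hE s ⟨x, hx⟩)
  rwa [twistEmb_restrictHomS_apply] at h

include hEU in
omit [IsGalois K E.1] [NumberField E.1] in
/-- With `V̄_E ≤ U`: such an element lies in `V_v` and in `N_{v,s}`. [cite: CasselsFrohlichANT1967, Ch. VII §1.1] -/
theorem mem_locLayerSubgroup_of_forall_smul (d : absoluteGaloisGroup (Place.Completion (Sum.inr v : Place K)))
    (hd : ∀ e : E.1, absGaloisRestrict K (v.adicCompletion K) d • twistEmb K S hE s e = twistEmb K S hE s e) :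
    ∃ hdV : d ∈ U.comap (decompMapPlaceS K S (Sum.inr v : Place K)),
      (⟨d, hdV⟩ : ↥(U.comap (decompMapPlaceS K S (Sum.inr v : Place K)))) ∈
        (comapOpenNormalSubgroup (conjHom (decompMapPlaceS K S (Sum.inr v : Place K)) U s)
          (continuous_conjHom (decompMapPlaceS K S (Sum.inr v : Place K)) (continuous_decompMapPlaceS K S _) U s)
          (traceOpenNormalSubgroup U (layerSubgroupS S E)) : Subgroup ↥(U.comap (decompMapPlaceS K S (Sum.inr v : Place K)))) := by
  have hmem := decompMapPlaceS_mem_layerSubgroupS_of_forall_smul K S hE v s d hd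
  refine ⟨Subgroup.mem_comap.2 (hEU hmem), ?_⟩
  rw [← locRestrict_eq_one_iff_mem K S U hE v s, locRestrict_eq_one_iff]
  exact hmem

end Restrict

/-! ## §2 The place `w_s` and the isomorphism `V_v ⧸ N_{v,s} ≃* G_{w_s}(E/L)` -/

section Decomp

/-- **The place `w_s ∣ v` of `E` cut out by `K̄ → K̄_v ∘ ι_s`** (`embPlace v ι_s`). [cite: CasselsFrohlichANT1967, Ch. II §10] -/
def locPlace : Place K E.1 v := embPlace v (twistEmb K S hE s)

/-- `ρ_s(d)` fixes `w_s`. [cite: CasselsFrohlichANT1967, Ch. VII §1.1] -/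
theorem locRestrict_smul_locPlace (d : absoluteGaloisGroup (Place.Completion (Sum.inr v : Place K))) :
    locRestrict K S hE v s d • locPlace K S hE v s = locPlace K S hE v s :=
  smul_embPlace_eq v (twistEmb K S hE s) (twistEmb_locRestrict K S hE v s d)

omit [IsGalois K E.1] [NumberField E.1] in
/-- **`L := E^{H_E}`**, the fixed field of the image `H_E` of `U` in `Gal(E/K)`. [cite: Harari2020, §17.5 Lemma 17.23] -/
abbrev locFixedField : IntermediateField K E.1 := IntermediateField.fixedField (subgroupImageS S hE U)

variable (u : HeightOneSpectrum (𝓞 (locFixedField K S U hE)))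
  (hu : (locPlace K S hE v s : HeightOneSpectrum (𝓞 E.1)).under (𝓞 (locFixedField K S U hE)) = u)

/-- **`w_s` as a place of `E` above the place `u` of `L` below it.** [cite: CasselsFrohlichANT1967, Ch. VII §1.1] -/
def locPlaceOver : Place (locFixedField K S U hE) E.1 u :=
  ⟨(locPlace K S hE v s : HeightOneSpectrum (𝓞 E.1)), hu⟩

omit hUn in
/-- `↑(locPlaceOver …) = ↑(locPlace …)` (definitional). [cite: CasselsFrohlichANT1967, Ch. VII §1.1] -/
@[simp] theorem coe_locPlaceOver :
    ((locPlaceOver K S U hE v s u hu : Place (locFixedField K S U hE) E.1 u) : HeightOneSpectrum (𝓞 E.1)) =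
      (locPlace K S hE v s : HeightOneSpectrum (𝓞 E.1)) := rfl

/-- **`V_v → G_{w_s}(E/L)`, `d ↦ ρ_s(d)`** as an `L`-automorphism fixing `w_s`. [cite: CasselsFrohlichANT1967, Ch. VII §1.1] -/
def locDecompHom :
    ↥(U.comap (decompMapPlaceS K S (Sum.inr v : Place K))) →*
      MulAction.stabilizer (E.1 ≃ₐ[locFixedField K S U hE] E.1) (locPlaceOver K S U hE v s u hu) where
  toFun d := ⟨algEquivFixedField _ (locRestrict K S hE v s d) (locRestrict_mem K S U hE v s d),
    MulAction.mem_stabilizer_iff.2 (Place.ext (by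
      change locRestrict K S hE v s d • (locPlace K S hE v s : HeightOneSpectrum (𝓞 E.1)) = _
      rw [Place.smul_coe, locRestrict_smul_locPlace]
      rfl))⟩
  map_one' := Subtype.ext (AlgEquiv.ext fun x => by simp)
  map_mul' d d' := Subtype.ext (AlgEquiv.ext fun x => by simp)

/-- Formula: `locDecompHom d`, restricted to `K`, is `ρ_s(d)`. [cite: CasselsFrohlichANT1967, Ch. VII §1.1] -/
@[simp] theorem restrictScalars_locDecompHom (d : ↥(U.comap (decompMapPlaceS K S (Sum.inr v : Place K)))) :
    ((locDecompHom K S U hE v s u hu d : E.1 ≃ₐ[locFixedField K S U hE] E.1)).restrictScalars K =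
      locRestrict K S hE v s d :=
  AlgEquiv.ext fun _ => rfl

/-- Formula on elements: `(locDecompHom d) e = ρ_s(d) e`. [cite: CasselsFrohlichANT1967, Ch. VII §1.1] -/
@[simp] theorem coe_locDecompHom_apply (d : ↥(U.comap (decompMapPlaceS K S (Sum.inr v : Place K)))) (e : E.1) :
    (locDecompHom K S U hE v s u hu d : E.1 ≃ₐ[locFixedField K S U hE] E.1) e = locRestrict K S hE v s d e := rfl

/-- **The kernel of `locDecompHom` is `N_{v,s}`.** [cite: Harari2020, §17.5 Lemma 17.23] -/
theorem ker_locDecompHom :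
    (locDecompHom K S U hE v s u hu).ker =
      (comapOpenNormalSubgroup (conjHom (decompMapPlaceS K S (Sum.inr v : Place K)) U s)
        (continuous_conjHom (decompMapPlaceS K S (Sum.inr v : Place K)) (continuous_decompMapPlaceS K S _) U s)
        (traceOpenNormalSubgroup U (layerSubgroupS S E)) : Subgroup ↥(U.comap (decompMapPlaceS K S (Sum.inr v : Place K)))) := by
  ext d
  rw [MonoidHom.mem_ker, ← locRestrict_eq_one_iff_mem K S U hE v s d]
  constructor
  · intro h
    refine AlgEquiv.ext fun x => ?_
    change (locDecompHom K S U hE v s u hu d : E.1 ≃ₐ[locFixedField K S U hE] E.1) x = x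
    rw [h, OneMemClass.coe_one, AlgEquiv.one_apply]
  · intro h
    refine Subtype.ext (AlgEquiv.ext fun x => ?_)
    change locRestrict K S hE v s d x = ((1 : MulAction.stabilizer (E.1 ≃ₐ[locFixedField K S U hE] E.1)
      (locPlaceOver K S U hE v s u hu)) : E.1 ≃ₐ[locFixedField K S U hE] E.1) x
    rw [h, OneMemClass.coe_one, AlgEquiv.one_apply, AlgEquiv.one_apply]

omit hUn in
/-- Step 1 of surjectivity: an automorphism of `E/L` fixing `w_s` is `ρ_s(d)` for some `d ∈ Γ_{K_v}`.
[cite: CasselsFrohlichANT1967, Ch. VII §1.1, Prop. 1.2] -/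
theorem exists_locRestrict_eq (g : E.1 ≃ₐ[locFixedField K S U hE] E.1)
    (hg : g • locPlaceOver K S U hE v s u hu = locPlaceOver K S U hE v s u hu) :
    ∃ d : absoluteGaloisGroup (Place.Completion (Sum.inr v : Place K)), locRestrict K S hE v s d = g.restrictScalars K := by
  have hgw : g.restrictScalars K • locPlace K S hE v s = locPlace K S hE v s :=
    Place.ext (by have h0' := congrArg Place.val hg; exact h0')
  obtain ⟨d, hd⟩ := exists_restrict_of_smul_embPlace_eq v (twistEmb K S hE s) hgw
  exact ⟨d, AlgEquiv.ext fun e => (twistEmb K S hE s).toRingHom.injective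
    ((twistEmb_locRestrict K S hE v s d e).trans (hd e).symm)⟩

include hEU in
omit [IsGalois K E.1] [NumberField E.1] in
/-- Step 2 of surjectivity: if `ρ_s(d) ∈ H_E` then `d ∈ V_v` (`φ_v d ∈ (s⁻¹ u s)·V̄_E ⊆ U` as `V̄_E ≤ U`).
[cite: Harari2020, §17.5 Lemma 17.23] -/
theorem mem_comap_of_locRestrict_mem (d : absoluteGaloisGroup (Place.Completion (Sum.inr v : Place K)))
    (hd : locRestrict K S hE v s d ∈ subgroupImageS S hE U) :
    d ∈ U.comap (decompMapPlaceS K S (Sum.inr v : Place K)) := by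
  obtain ⟨u₀, hu₀U, hu₀⟩ := Subgroup.mem_map.1 hd
  rw [Subgroup.mem_comap]
  -- `restrictHomS (φ_v d) = restrictHomS (s⁻¹ u₀ s)`
  have hR : restrictHomS S hE (decompMapPlaceS K S (Sum.inr v : Place K) d) = restrictHomS S hE (s⁻¹ * u₀ * s) := by
    rw [map_mul, map_mul, map_inv, hu₀, locRestrict_apply]
    group
  have h2 : (s⁻¹ * u₀ * s)⁻¹ * decompMapPlaceS K S (Sum.inr v : Place K) d ∈
      (layerSubgroupS S E : Subgroup (GaloisGroupUnramifiedOutside K (↑S : Set (HeightOneSpectrum (𝓞 K))))) := by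
    rw [← restrictHomS_eq_one_iff S hE, map_mul, map_inv, hR, inv_mul_cancel]
  have h3 : s⁻¹ * u₀ * s ∈ U := by
    have h3' := hUn.conj_mem u₀ hu₀U s⁻¹
    rwa [inv_inv] at h3'
  have h4 := U.mul_mem h3 (hEU h2)
  rwa [mul_inv_cancel_left] at h4

include hEU in
/-- **`locDecompHom` is onto**: an automorphism of `E/L` fixing `w_s` restricts to an element of `H_E` fixing `w_s`, which is
`ρ_s(d)` for some `d ∈ Γ_{K_v}` (`Γ_{K_v} ↠ G_{w_s}(E/K)`), and then `d ∈ V_v`. [cite: CasselsFrohlichANT1967, Ch. VII §1.1, Prop. 1.2] -/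
theorem locDecompHom_surjective : Function.Surjective (locDecompHom K S U hE v s u hu) := by
  rintro ⟨g, hg⟩
  obtain ⟨d, hρ⟩ := exists_locRestrict_eq K S U hE v s u hu g (MulAction.mem_stabilizer_iff.1 hg)
  have hdV : d ∈ U.comap (decompMapPlaceS K S (Sum.inr v : Place K)) :=
    mem_comap_of_locRestrict_mem K S U hE hEU v s d (hρ ▸ restrictScalars_mem_of_fixedField _ g)
  refine ⟨⟨d, hdV⟩, Subtype.ext (AlgEquiv.ext fun e => ?_)⟩
  change locRestrict K S hE v s d e = g e
  rw [hρ]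
  rfl

/-- **`V_v ⧸ N_{v,s} ≃* G_{w_s}(E/L)`.** [cite: CasselsFrohlichANT1967, Ch. VII §1.1][cite: Harari2020, §17.5 Lemma 17.23] -/
def locDecompEquiv :
    ↥(U.comap (decompMapPlaceS K S (Sum.inr v : Place K))) ⧸
        (comapOpenNormalSubgroup (conjHom (decompMapPlaceS K S (Sum.inr v : Place K)) U s)
          (continuous_conjHom (decompMapPlaceS K S (Sum.inr v : Place K)) (continuous_decompMapPlaceS K S _) U s)
          (traceOpenNormalSubgroup U (layerSubgroupS S E)) : Subgroup ↥(U.comap (decompMapPlaceS K S (Sum.inr v : Place K)))) ≃*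
      MulAction.stabilizer (E.1 ≃ₐ[locFixedField K S U hE] E.1) (locPlaceOver K S U hE v s u hu) :=
  QuotientGroup.liftEquiv _ (locDecompHom_surjective K S U hE hEU v s u hu) (ker_locDecompHom K S U hE v s u hu).symm

/-- Formula: `locDecompEquiv [d] = locDecompHom d`. [cite: CasselsFrohlichANT1967, Ch. VII §1.1] -/
@[simp] theorem locDecompEquiv_mk (d : ↥(U.comap (decompMapPlaceS K S (Sum.inr v : Place K)))) :
    locDecompEquiv K S U hE hEU v s u hu (QuotientGroup.mk d) = locDecompHom K S U hE v s u hu d := rfl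

end Decomp

/-! ## §2b The place `w_s` and the embedding `placeEmb v ι_s` in the CANONICAL currency (`ι = E ⊆ K̄`, `w̄_E = embPlace v ι`) -/

section Canonical

omit hUn in
/-- The `K_v`-algebra map `E_{g • w} → E_w → K̄_v`, `y ↦ placeEmb_ι (g⁻¹_* y)`, for the canonical embedding `ι : E ⊆ K̄` and
`w = w̄_E = embPlace v ι` (auxiliary). [cite: CasselsFrohlichANT1967, Ch. VII §1.1] -/
def canonicalCompAux (g : E.1 ≃ₐ[K] E.1) {w : Place K E.1 v}
    (h : g⁻¹ • (w : HeightOneSpectrum (𝓞 E.1)) = ((embPlace v E.1.val : Place K E.1 v) : HeightOneSpectrum (𝓞 E.1))) :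
    ((w : HeightOneSpectrum (𝓞 E.1)).adicCompletion E.1) →ₐ[v.adicCompletion K] AlgebraicClosure (v.adicCompletion K) :=
  (placeEmb v E.1.val).comp
    { toRingHom := galAdicCompletionMap g⁻¹ h
      commutes' := fun c => by
        change galAdicCompletionMap g⁻¹ h (algebraMap _ _ c) = algebraMap _ _ c
        rw [algebraMap_place_eq, algebraMap_place_eq]
        exact galAdicCompletionMap_adicCompletionOfLiesOver K g⁻¹ v h c }

omit hUn in
/-- Formula on `E`: `canonicalCompAux g (e) = ι_v (g⁻¹ e)`. [cite: CasselsFrohlichANT1967, Ch. VII §1.1] -/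
theorem canonicalCompAux_algebraMap (g : E.1 ≃ₐ[K] E.1) {w : Place K E.1 v}
    (h : g⁻¹ • (w : HeightOneSpectrum (𝓞 E.1)) = ((embPlace v E.1.val : Place K E.1 v) : HeightOneSpectrum (𝓞 E.1))) (e : E.1) :
    canonicalCompAux K v g h (algebraMap E.1 _ e) =
      absClosureEmbedding K (v.adicCompletion K) ((g⁻¹ e : E.1) : AlgebraicClosure K) := by
  change placeEmb v E.1.val (galAdicCompletionMap g⁻¹ h ((e : E.1) : (w : HeightOneSpectrum (𝓞 E.1)).adicCompletion E.1)) = _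
  rw [galAdicCompletionMap_coe_algEquiv, placeEmb_coe]
  rfl

/-- **`w_s = g_s • w̄_E`**: the place cut out by the twisted embedding `ι_s = ι ∘ g_s⁻¹` is the `g_s`-translate of the place
cut out by the canonical one (rigidity `eq_embPlace_of_algHom` applied to `placeEmb_ι ∘ (g_s⁻¹)_*`). In bsd-line-x1-p1-w7 g14's
(iii) currency: `x₀ := embPlace v E.1.val`, `π := restrictHomS S hE`. [cite: CasselsFrohlichANT1967, Ch. VII §1.1][cite: NeukirchANT1999, Ch. II (8.3)] -/
theorem smul_embPlace_eq_locPlace :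
    restrictHomS S hE s • embPlace v E.1.val = locPlace K S hE v s := by
  have h : (restrictHomS S hE s)⁻¹ • ((restrictHomS S hE s • embPlace v E.1.val : Place K E.1 v) : HeightOneSpectrum (𝓞 E.1)) =
      ((embPlace v E.1.val : Place K E.1 v) : HeightOneSpectrum (𝓞 E.1)) := by
    rw [Place.coe_smul, inv_smul_smul]
  refine eq_embPlace_of_algHom v (twistEmb K S hE s) (canonicalCompAux K v (restrictHomS S hE s) h) fun e => ?_
  rw [canonicalCompAux_algebraMap, twistEmb_apply, AlgEquiv.aut_inv]

/-- Coerced form: `↑w_s = g_s • ↑w̄_E` in the places of `E`. [cite: CasselsFrohlichANT1967, Ch. VII §1.1] -/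
theorem coe_locPlace_eq_smul :
    (locPlace K S hE v s : HeightOneSpectrum (𝓞 E.1)) =
      restrictHomS S hE s • ((embPlace v E.1.val : Place K E.1 v) : HeightOneSpectrum (𝓞 E.1)) := by
  rw [← smul_embPlace_eq_locPlace, Place.coe_smul]

/-- `g_s⁻¹ • ↑w_s = ↑w̄_E` (the transport datum for `galAdicCompletionMap g_s⁻¹ : E_{w_s} → E_{w̄_E}`).
[cite: CasselsFrohlichANT1967, Ch. VII §1.1] -/
theorem inv_smul_coe_locPlace :
    (restrictHomS S hE s)⁻¹ • (locPlace K S hE v s : HeightOneSpectrum (𝓞 E.1)) =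
      ((embPlace v E.1.val : Place K E.1 v) : HeightOneSpectrum (𝓞 E.1)) := by
  rw [coe_locPlace_eq_smul, inv_smul_smul]

/-- **The twisted embedding through the canonical one: `placeEmb_{ι_s} y = placeEmb_ι ((g_s⁻¹)_* y)`** for `y ∈ E_{w_s}`
(rigidity `algHom_eq_placeEmb`): reading a local component at `w_s` through `ι_s` is reading the `g_s⁻¹`-transported component at
`w̄_E` through `ι` — the dictionary between this file's `placeEmb v (twistEmb …)` and door-c6's canonical idèle projection.
[cite: CasselsFrohlichANT1967, Ch. VII §1.1][cite: NeukirchANT1999, Ch. II (8.3)] -/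
theorem placeEmb_twistEmb_eq (y : (locPlace K S hE v s : HeightOneSpectrum (𝓞 E.1)).adicCompletion E.1) :
    placeEmb v (twistEmb K S hE s) y =
      placeEmb v E.1.val (galAdicCompletionMap (restrictHomS S hE s)⁻¹ (inv_smul_coe_locPlace K S hE v s) y) := by
  have hΦ := algHom_eq_placeEmb v (twistEmb K S hE s)
    (canonicalCompAux K v (restrictHomS S hE s) (inv_smul_coe_locPlace K S hE v s)) fun e => by
      rw [canonicalCompAux_algebraMap, twistEmb_apply, AlgEquiv.aut_inv]
  exact (AlgHom.congr_fun hΦ y).symm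

end Canonical

end IdeleReadout

end Literature.NumberTheory.GaloisRepresentations

end
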